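import Summits.QuantumFields.GaugeBoot.BootstrapConvergence
import HarnessLib

/-!
# The word-length truncation of the lattice bootstrap converges to the Wilson value (gauge-boot, L1 supplement)

HONEST FRAMING (cell `pub-gaugeboot`, page 1 of every file): the venture produces certified bounds
on lattice expectations at stated coupling, gauge group, dimension and torus size; NOT a mass gap,
NOT a continuum limit, NOT a string tension; NOT Yang–Mills-summit-bearing (barriers
`FixedCouplingUltralocality`, `PerturbativeInvisibility`). Structural; it certifies no number
and says nothing about RATES of convergence.

## Content

The canonical truncation scheme of the lattice bootstrap (Anderson–Kruczenski, Kazakov–Zheng):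
level `n` uses as test functions the linear combinations of WORDS OF LENGTH `≤ n` in the matrix
entries of the link variables (`wordsUpTo`, `wordTruncation`), i.e. Wilson lines / loops of
bounded length.

* `wordTruncation_mono`, `wordTruncation_subset_polyAlgebra`, `eventually_mem_wordTruncation` —
  it is an increasing scheme of polynomial test functions exhausting the polynomial observables;
* ★★★ `bootstrap_convergence_words_suN` / `_uN` — `SU(N)` / `U(N)` on the torus `(ℤ/L)^d`, ANY
  real `β`, every polynomial observable `P`, every `ε > 0`: for all sufficiently large `n`, EVERY
  value `φ P` feasible at word level `n` (normalisation, PSD of the level-`n` moment matrix, loop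
  equations with level-`n` test functions) satisfies `|φ P - ∫ P dμ_Wilson| ≤ ε`;
* `wilson_mem_levelValues_suN` + ★★★ `levelValues_subset_Icc_suN` — the set of level-`n` feasible
  values of `P` contains the Wilson value and is eventually inside `[W - ε, W + ε]`: the SDP lower
  and upper bounds of the truncated bootstrap CONVERGE to the Wilson expectation, in finite volume,
  at every coupling.

References: P. Anderson, M. Kruczenski, Nucl. Phys. B 921 (2017) §2–3; V. Kazakov, Z. Zheng,
arXiv:2203.11360 §2 (truncation by maximal loop length `L_max`); Z. Li, S. Zhou,
arXiv:2404.17071. Folklore.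
-/

noncomputable section

open MeasureTheory Filter Topology NormedSpace
open Literature.MathematicalPhysics.QuantumFieldTheory (LatticeRep)

namespace Summit.QuantumFields.GaugeBoot

/-! ## Words of bounded length -/

section Words

variable {ι : Type*} {G : Type*} [Group G] [TopologicalSpace G] (r : LatticeRep G)

/-- **Words of length `≤ n`** in the generators `Re/Im ρ(U_e)_{ab}` (products of at most `n` matrix
entries of link variables: open strings / Wilson lines of length `≤ n`). [folklore] -/
def wordsUpTo (n : ℕ) : Set C(ι → G, ℝ) :=
  {m | ∃ l : List C(ι → G, ℝ), (∀ x ∈ l, x ∈ entryGens (ι := ι) r) ∧ l.length ≤ n ∧ l.prod = m}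

/-- **The level-`n` test functions of the word-length truncation**: linear combinations of words of
length `≤ n`. [folklore] -/
def wordTruncation (n : ℕ) : Set C(ι → G, ℝ) :=
  (Submodule.span ℝ (wordsUpTo (ι := ι) r n) : Set C(ι → G, ℝ))

/-- Longer maximal length, more words. -/
theorem wordsUpTo_mono : Monotone (wordsUpTo (ι := ι) r) := by
  intro n m hnm w hw
  obtain ⟨l, hl, hlen, hprod⟩ := hw
  exact ⟨l, hl, hlen.trans hnm, hprod⟩

/-- **The word-length truncation is an increasing scheme.** -/
theorem wordTruncation_mono : Monotone (wordTruncation (ι := ι) r) :=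
  fun _ _ hnm => Submodule.span_mono (wordsUpTo_mono r hnm)

/-- Words are monomials in the generators. -/
theorem wordsUpTo_subset_closure (n : ℕ) :
    wordsUpTo (ι := ι) r n ⊆ Submonoid.closure (entryGens (ι := ι) r) := by
  rintro w ⟨l, hl, -, rfl⟩
  exact Submonoid.list_prod_mem _ fun x hx => Submonoid.subset_closure (hl x hx)

/-- **Level-`n` test functions are polynomial observables.** -/
theorem wordTruncation_subset_polyAlgebra (n : ℕ) :
    wordTruncation (ι := ι) r n ⊆ polyAlgebra (ι := ι) r := by
  intro a ha
  have h : Submodule.span ℝ (wordsUpTo (ι := ι) r n) ≤ Subalgebra.toSubmodule (polyAlgebra (ι := ι) r) :=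
    Submodule.span_le.2 fun w hw =>
      mem_polyAlgebra_of_mem_closure r (wordsUpTo_subset_closure r n hw)
  exact h ha

/-- ★ **The word-length truncation exhausts the polynomial observables**: every polynomial is a
level-`n` test function for all large `n`. [folklore] -/
theorem eventually_mem_wordTruncation {a : C(ι → G, ℝ)} (ha : a ∈ polyAlgebra (ι := ι) r) :
    ∀ᶠ n in atTop, a ∈ wordTruncation (ι := ι) r n := by
  classical
  have ha' : a ∈ Submodule.span ℝ (Submonoid.closure (entryGens (ι := ι) r) : Set C(ι → G, ℝ)) := by
    have h := Algebra.adjoin_eq_span ℝ (entryGens (ι := ι) r)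
    rw [← Subalgebra.mem_toSubmodule, polyAlgebra, h] at ha
    exact ha
  obtain ⟨k, c, g, hsum⟩ := Submodule.mem_span_set'.1 ha'
  have hl : ∀ j, ∃ l : List C(ι → G, ℝ), (∀ x ∈ l, x ∈ entryGens (ι := ι) r) ∧ l.prod = (g j : C(ι → G, ℝ)) :=
    fun j => Submonoid.exists_list_of_mem_closure (g j).2
  choose l hl hlprod using hl
  refine eventually_atTop.2 ⟨Finset.univ.sup fun j => (l j).length, fun n hn => ?_⟩
  rw [wordTruncation, SetLike.mem_coe, ← hsum]
  refine Submodule.sum_mem _ fun j _ => Submodule.smul_mem _ _ (Submodule.subset_span ⟨l j, hl j, ?_, hlprod j⟩)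
  exact (Finset.le_sup (f := fun j => (l j).length) (Finset.mem_univ j)).trans hn

end Words

/-! ## `SU(N)` and `U(N)` on the torus: the word-length truncation converges -/

section Unitary

open Literature.MathematicalPhysics.QuantumFieldTheory (Edge GaugeConfig wilsonAction wilsonMeasure)
open Literature.MathematicalPhysics.QuantumLattice

variable {d L : ℕ}

/-- ★★★ **Convergence of the word-length truncated `SU(N)` bootstrap.** Torus `(ℤ/L)^d`, ANY real
`β`, every polynomial observable `P`, every `ε > 0`: for all sufficiently large `n`, every value of
`P` feasible at word level `n` is within `ε` of the Wilson expectation. [folklore] -/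
theorem bootstrap_convergence_words_suN [NeZero L] (N : ℕ) (β : ℝ)
    {P : C(GaugeConfig d L (Matrix.specialUnitaryGroup (Fin N) ℂ), ℝ)}
    (hP : P ∈ polyAlgebra (ι := Edge d L) (fundamentalLatticeRep N)) {ε : ℝ} (hε : 0 < ε) :
    ∀ᶠ n in atTop, ∀ φ : C(GaugeConfig d L (Matrix.specialUnitaryGroup (Fin N) ℂ), ℝ) →ₗ[ℝ] ℝ,
      IsBootstrapFeasible (fundamentalLatticeRep N) (suExp N)
          (fun _ => wilsonAction (fundamentalRep (Fin N))) β
          (wordTruncation (ι := Edge d L) (fundamentalLatticeRep N) n) φ →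
        |φ P - ∫ U, P U ∂(wilsonMeasure (fundamentalRep (Fin N)) β)| ≤ ε :=
  bootstrap_convergence_of_unique_mono (fundamentalLatticeRep N) (suExp_add N)
    (X := fun X : SuGenerator N => (X : Matrix (Fin N) (Fin N) ℂ)) (rho_suExp N)
    (fun _ => wilsonAction_mem_polyFunctions (fundamentalLatticeRep N)) _
    (wordTruncation_mono _) (fun _ ha => eventually_mem_wordTruncation _ ha) hP
    (fun _ hψ => eq_wilson_of_bootstrap_suN N β hψ.1 hψ.2.1 hψ.2.2 hP) hε

/-- ★★★ **Convergence of the word-length truncated `U(N)` bootstrap** (shifts `e^{tX}`,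
`X ∈ 𝔲(N)`). [folklore] -/
theorem bootstrap_convergence_words_uN [NeZero L] (N : ℕ) (β : ℝ)
    {P : C(GaugeConfig d L (Matrix.unitaryGroup (Fin N) ℂ), ℝ)}
    (hP : P ∈ polyAlgebra (ι := Edge d L) (unitaryFundamentalLatticeRep N)) {ε : ℝ} (hε : 0 < ε) :
    ∀ᶠ n in atTop, ∀ φ : C(GaugeConfig d L (Matrix.unitaryGroup (Fin N) ℂ), ℝ) →ₗ[ℝ] ℝ,
      IsBootstrapFeasible (unitaryFundamentalLatticeRep N) (uExp N)
          (fun _ => wilsonAction (unitaryFundamentalRep (Fin N) ℂ)) β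
          (wordTruncation (ι := Edge d L) (unitaryFundamentalLatticeRep N) n) φ →
        |φ P - ∫ U, P U ∂(wilsonMeasure (unitaryFundamentalRep (Fin N) ℂ) β)| ≤ ε :=
  bootstrap_convergence_of_unique_mono (unitaryFundamentalLatticeRep N) (uExp_add N)
    (X := fun X : UGenerator N => (X : Matrix (Fin N) (Fin N) ℂ)) (rho_uExp N)
    (fun _ => wilsonAction_mem_polyFunctions (unitaryFundamentalLatticeRep N)) _
    (wordTruncation_mono _) (fun _ ha => eventually_mem_wordTruncation _ ha) hP
    (fun _ hψ => eq_wilson_of_bootstrap_uN N β hψ.1 hψ.2.1 hψ.2.2 hP) hε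

/-- **The set of values of `P` feasible at word level `n`** (`SU(N)`, torus) — the interval an SDP
bounds from both sides. [folklore] -/
def levelValuesSuN [NeZero L] (N : ℕ) (β : ℝ) (n : ℕ)
    (P : C(GaugeConfig d L (Matrix.specialUnitaryGroup (Fin N) ℂ), ℝ)) : Set ℝ :=
  {t | ∃ φ : C(GaugeConfig d L (Matrix.specialUnitaryGroup (Fin N) ℂ), ℝ) →ₗ[ℝ] ℝ,
    IsBootstrapFeasible (fundamentalLatticeRep N) (suExp N)
        (fun _ => wilsonAction (fundamentalRep (Fin N))) β
        (wordTruncation (ι := Edge d L) (fundamentalLatticeRep N) n) φ ∧ φ P = t}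

/-- **The Wilson value is feasible at every word level**: the truncations are relaxations.
[folklore] -/
theorem wilson_mem_levelValues_suN [NeZero L] (N : ℕ) (β : ℝ) (n : ℕ)
    (P : C(GaugeConfig d L (Matrix.specialUnitaryGroup (Fin N) ℂ), ℝ)) :
    ∫ U, P U ∂(wilsonMeasure (fundamentalRep (Fin N)) β) ∈ levelValuesSuN (d := d) (L := L) N β n P := by
  haveI : IsProbabilityMeasure (wilsonMeasure (d := d) (L := L) (fundamentalRep (Fin N)) β) :=
    Literature.MathematicalPhysics.QuantumFieldTheory.isProbabilityMeasure_wilsonMeasure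
      (ρ := fundamentalRep (Fin N)) (continuous_fundamentalRep _) β
  exact ⟨expectationFunctional (wilsonMeasure (fundamentalRep (Fin N)) β),
    isBootstrapFeasible_wilson_suN N β _ rfl (wordTruncation_subset_polyAlgebra _ n), rfl⟩

/-- ★★★ **The truncated bootstrap bounds converge to the Wilson value.** For every polynomial
observable `P` and `ε > 0`, for all large `n` the level-`n` feasible values of `P` — a set containing
the Wilson expectation `W` — lie in `[W - ε, W + ε]`. [folklore] -/
theorem levelValues_subset_Icc_suN [NeZero L] (N : ℕ) (β : ℝ)
    {P : C(GaugeConfig d L (Matrix.specialUnitaryGroup (Fin N) ℂ), ℝ)}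
    (hP : P ∈ polyAlgebra (ι := Edge d L) (fundamentalLatticeRep N)) {ε : ℝ} (hε : 0 < ε) :
    ∀ᶠ n in atTop, levelValuesSuN (d := d) (L := L) N β n P ⊆
      Set.Icc (∫ U, P U ∂(wilsonMeasure (fundamentalRep (Fin N)) β) - ε)
        (∫ U, P U ∂(wilsonMeasure (fundamentalRep (Fin N)) β) + ε) := by
  filter_upwards [bootstrap_convergence_words_suN N β hP hε] with n hn
  rintro t ⟨φ, hφ, rfl⟩
  have h := abs_le.1 (hn φ hφ)
  exact ⟨by linarith [h.1], by linarith [h.2]⟩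

end Unitary

end Summit.QuantumFields.GaugeBoot

end
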